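import Summits.ResolutionOfSingularities.ResolutionOfSingularities.Theorems.FrobeniusLadderFInjectiveMacaulayficationSigma3P2d4F5NewtonKFan
import Summits.ResolutionOfSingularities.ResolutionOfSingularities.Theorems.FrobeniusLadderFInjectiveMacaulayficationSigma3P2d4F5PointFloor
import Summits.ResolutionOfSingularities.ResolutionOfSingularities.Theorems.FrobeniusLadderFInjectiveMacaulayficationFHalfRowOfWeaklyNondegenerate
import Summits.ResolutionOfSingularities.ResolutionOfSingularities.Theorems.FrobeniusLadderFInjectiveMacaulayficationFHalfRowOfToricCoverData
import Summits.ResolutionOfSingularities.ResolutionOfSingularities.Theorems.FrobeniusLadderFInjectiveMacaulayficationPolyAutRowTransport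
import HarnessLib

/-!
# ★★★ CLASS-ROUTE COVERAGE PROGRAMME, P2d4F5: `f′ = σ₃(f_P2d4F5) = z² + x²z + x⁵ + x⁶ + y⁵ + u⁵ + t⁵` (char 2) BY THE CLASS THEOREM — the point floor of `V(f′)` is cured by the monomial
# blowing up `𝔪·K` read off the `Σ_f′ ∧ Σ(𝔪)` fan (37 charts), with NO Fedder cell — and, by transport along `σ₃ : z ↦ z + x³` (res-L1-w45a-stub-1ʼs `PolyAutRowTransport`), THE
# POINT-FLOOR ROW AND THE GERM ROW OF THE CENSUS BED P2d4F5 `z² + x²z + y⁵ + u⁵ + t⁵` (row #2ʼs bed, ✓ p627561 at the τ-floor; germ ✓ p612829)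
# (crux `FInjectiveMacaulayfication` stmt-ResolutionOfSingularities-15315, chain w45a; res-L1-w45a-plan-1 RULING R22.14 (2) «CLASS-ROUTE COVERAGE PROGRAMME — the p = 2 beds, smallest
# fan first»; seat res-L1-w45a-stub-2 g11; template = this seatʼs pilot ✓ p681805 `Sigma5P2d4CPointFloorRowClass`)

[OURS · L1 W4.5a] Support file (`--supports stmt-ResolutionOfSingularities-15315 --as helper`); def-free, unconditional; replaces the role of NO printed item;
NOT a statement of the manuscript; AI-written (AI review is weaker than expert review). A cross-certificate / new point-floor row of a census bed, OURS counted 0; nothing of the crux is proved.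

`X′ = Spec (k[X₀..X₄]/(f′))`, `f′ = X4 ^ 2 + X0 ^ 2 * X4 + X0 ^ 5 + X0 ^ 6 + X1 ^ 5 + X2 ^ 5 + X3 ^ 5`, `k = k̄` of characteristic 2, `v` = the vertex, floor centre `𝔪`,
`A = 𝔪·K` = `genSet 5 Sigma3P2d4F5NewtonKFan.AL2` (485 generators, `|K| = 97`; fan `P2d4F5s3b_fan.json` (37 cones / 12 rays), certificate `P2d4F5s3b_cover.json` 5f807050cacb6fc0).
* §0–§2: refining strict transforms, `affineBlowup_mK_fullCl_class` (✓ p656605 §2), ★★ `pointFloor_sigma3F5_row_class` (the cure, ✓ p656605 §3);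
* §3 ★★ `f4pos_row_sigma3F5_class` = LEGAL ∧ NOT F(4)-iso (p = 2) ∧ CURED for `V(f′)` (input side `Sigma3P2d4F5PointFloor`: the NOT-FULL witness is the `y`-chart origin);
* §4 ★ `sigma3F5_fInjectivizationGermAt : FInjectivizationGermAt 2 v`;
* §5 `aeval_shift_f5` (`σ₃ f = f′` in char 2), ★★★ `pointFloorRow_P2d4F5_class` / `p2d4f5_fInjectivizationGermAt_class` — the same two statements for P2d4F5 `f = X4 ^ 2 + X0 ^ 2 * X4 + X1 ^ 5 + X2 ^ 5 +
  X3 ^ 5` by `PolyAutRowTransport.exists_translate k 0 4 _ 1 3` + `pointFloorRow_of_algEquiv 2` / `fInjectivizationGermAt_of_algEquiv 2`. `k = k̄` is the one extra hypothesis.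
[OURS · certificate instance + assembly of landed theorems] [cite: IshiiSingularities2018, Thm. 4.4.23, Lemma 4.4.24, Cor. 4.4.25 (pp. 95–97)] [cite: StacksProject, Tag 080A]
[cite: GortzWedhorn2020, Prop. 13.91 (2), (13.19)]
-/

-- single-problem summit: the doubled namespace component is forced
set_option linter.dupNamespace false

noncomputable section

open AlgebraicGeometry CategoryTheory Literature.AlgebraicGeometry.Resolution TopologicalSpace IsLocalRing MvPolynomial

namespace Summit.ResolutionOfSingularities.ResolutionOfSingularities.Theorems.FInjectiveMacaulayfication.Sigma3P2d4F5PointFloorRowClass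

open Summit.ResolutionOfSingularities.ResolutionOfSingularities.Theorems.FInjectiveMacaulayfication
open SliceableCentre GermForm FanCheckKit Sigma3P2d4F5NewtonKFan

/-! ## §0 The refining strict transforms from the Newton minimisers -/

/-- On every chart of the `Σ_f′ ∧ Σ(𝔪)` fan, `θ_{V c} f′ = Y^{V c · u₀ c} · g_c` with `g_c(0) ≠ 0` — the Newton chart lemma on the tabulated common minimiser.
[cite: IshiiSingularities2018, proof of Lemma 4.4.24 (p. 96)] -/
theorem exists_refining_strictTransform (k : Type) [Field k] (f : MvPolynomial (Fin 5) k)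
    (hf : f = X 4 ^ 2 + X 0 ^ 2 * X 4 + X 0 ^ 5 + X 0 ^ 6 + X 1 ^ 5 + X 2 ^ 5 + X 3 ^ 5) (c : Fin 37) :
    ∃ g : MvPolynomial (Fin 5) k, aeval (fun j : Fin 5 => ∏ i : Fin 5, (X i : MvPolynomial (Fin 5) k) ^ Vq c i j) f =
      monomial (Finsupp.equivFunOnFinite.symm ((Vq c).mulVec ⇑(Finsupp.equivFunOnFinite.symm (U0 c) : Fin 5 →₀ ℕ))) 1 * g ∧ constantCoeff g ≠ 0 :=
  NewtonChartLemma.exists_theta_eq_monomial_mul_of_commonMinimiser (Vq c) (hV c) f _ (hu₀ k f hf c) (hmin k f hf c)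

/-! ## §1 `Bl_{𝔪·K} X′` is FULL everywhere -/

/-- ★ **`Bl_{𝔪·K} X′` IS FULL AT EVERY POINT** (class route: weak non-degeneracy + Newton fan cover data; no Fedder cell). [OURS · certificate instance]
[cite: IshiiSingularities2018, Thm. 4.4.23 and Cor. 4.4.25] -/
theorem affineBlowup_mK_fullCl_class (k : Type) [Field k] [IsAlgClosed k] [CharP k 2] (f : MvPolynomial (Fin 5) k)
    (hf : f = X 4 ^ 2 + X 0 ^ 2 * X 4 + X 0 ^ 5 + X 0 ^ 6 + X 1 ^ 5 + X 2 ^ 5 + X 3 ^ 5) :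
    ∀ y : ↥(affineBlowup (Ideal.span ((fun e : Fin 5 →₀ ℕ => Ideal.Quotient.mk (Ideal.span {f}) (monomial e (1 : k))) '' (genSet 5 AL2 : Set (Fin 5 →₀ ℕ))))),
      FullCl 2 ((affineBlowup (Ideal.span ((fun e : Fin 5 →₀ ℕ => Ideal.Quotient.mk (Ideal.span {f}) (monomial e (1 : k))) '' (genSet 5 AL2 : Set (Fin 5 →₀ ℕ))))).presheaf.stalk y) := by
  classical
  haveI : Fact (Nat.Prime 2) := ⟨Nat.prime_two⟩
  choose g hθ hg0 using exists_refining_strictTransform k f hf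
  exact FHalfRowOfNewtonNondegenerate.affineBlowup_fullCl_of_weaklyNondegenerate 2 k f (Sigma3P2d4F5Specimen.prime_f k f hf)
    (Sigma3P2d4F5Specimen.weaklyNondegenerate k f hf) (Sigma3P2d4F5Specimen.mk_X_ne_zero k f hf)
    (fun x hx => Sigma3P2d4F5Specimen.regular_off_vertex k f hf x.asIdeal hx)
    (genSet 5 AL2) hprimAJ.2.1 hprimAJ.1 37 (chartM 5 AL2 CL 37) (hcov k) Vq hV (chartA 5 AL2 CL 37) haA hgen hge g _ hθ hg0 (Sigma3P2d4F5NewtonKFan.hv k _)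

/-! ## §2 ★★ The cure of the point floor, by the class theorem -/

/-- ★★ **THE POINT FLOOR OF `V(f′)` IS CURED — BY THE CLASS THEOREM** (`k = k̄`, char 2). See the module docstring. [OURS · certificate instance]
[cite: IshiiSingularities2018, Thm. 4.4.23 and Cor. 4.4.25] [cite: StacksProject, Tag 080A] -/
theorem pointFloor_sigma3F5_row_class (k : Type) [Field k] [IsAlgClosed k] [CharP k 2] (f : MvPolynomial (Fin 5) k)
    (hf : f = X 4 ^ 2 + X 0 ^ 2 * X 4 + X 0 ^ 5 + X 0 ^ 6 + X 1 ^ 5 + X 2 ^ 5 + X 3 ^ 5)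
    (v : Spec (.of (MvPolynomial (Fin 5) k ⧸ Ideal.span {f})))
    (hv : v.asIdeal = Ideal.span (Set.range (fun j : Fin 5 => Ideal.Quotient.mk (Ideal.span {f}) (X j)))) :
    ∀ (S' : Scheme.{0}) (g : S' ⟶ Spec ((Spec (.of (MvPolynomial (Fin 5) k ⧸ Ideal.span {f}))).presheaf.stalk v)),
      IsBlowup g ((affineBlowup.idealSheaf (Ideal.span (Set.range (fun j : Fin 5 => Ideal.Quotient.mk (Ideal.span {f}) (X j))))).comap
        ((Spec (.of (MvPolynomial (Fin 5) k ⧸ Ideal.span {f}))).fromSpecStalk v)) →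
      ∃ 𝓚 : S'.IdealSheafData, 𝓚 ≠ ⊥ ∧
        (∀ s ∈ (𝓚.support : Set S'), g.base s = closedPoint ((Spec (.of (MvPolynomial (Fin 5) k ⧸ Ideal.span {f}))).presheaf.stalk v)) ∧
        ∀ (S'' : Scheme.{0}) (π : S'' ⟶ S'), IsBlowup π 𝓚 → ∀ s : S'', FullCl 2 (S''.presheaf.stalk s) := by
  classical
  haveI : Fact (Nat.Prime 2) := ⟨Nat.prime_two⟩
  choose g hθ hg0 using exists_refining_strictTransform k f hf
  exact FHalfRowOfNewtonNondegenerate.fHalfRow_of_weaklyNondegenerate 2 k (by norm_num) f (Sigma3P2d4F5Specimen.prime_f k f hf)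
    (Sigma3P2d4F5Specimen.weaklyNondegenerate k f hf) (Sigma3P2d4F5Specimen.mk_X_ne_zero k f hf)
    (fun x hx => Sigma3P2d4F5Specimen.regular_off_vertex k f hf x.asIdeal hx)
    (genSet 5 AL2) (genSet 5 KL2) (span_A_eq_floor_mul_K k _).1 hKprim.1 hprimAJ.2.1 hprimAJ.1 37 (chartM 5 AL2 CL 37) (hcov k) Vq hV
    (chartA 5 AL2 CL 37) haA hgen hge g _ hθ hg0 (Sigma3P2d4F5NewtonKFan.hv k _) v hv

/-! ## §3 ★★ The two-sided row for `V(f′)`, by the class route -/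

/-- ★★ **THE TWO-SIDED ROW FOR `V(f′)` AT THE POINT FLOOR: LEGAL ∧ NOT F(4)-iso (p = 2) ∧ CURED** (`k = k̄`). The first two conjuncts are this seatʼs `Sigma3P2d4F5PointFloor`
(input side), the third is §2. [OURS · assembly of landed theorems] -/
theorem f4pos_row_sigma3F5_class (k : Type) [Field k] [IsAlgClosed k] [CharP k 2] (f : MvPolynomial (Fin 5) k)
    (hf : f = X 4 ^ 2 + X 0 ^ 2 * X 4 + X 0 ^ 5 + X 0 ^ 6 + X 1 ^ 5 + X 2 ^ 5 + X 3 ^ 5)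
    (v : Spec (.of (MvPolynomial (Fin 5) k ⧸ Ideal.span {f})))
    (hv : v.asIdeal = Ideal.span (Set.range (fun j : Fin 5 => Ideal.Quotient.mk (Ideal.span {f}) (X j))))
    (S' : Scheme.{0}) (g : S' ⟶ Spec ((Spec (.of (MvPolynomial (Fin 5) k ⧸ Ideal.span {f}))).presheaf.stalk v))
    (hg : IsBlowup g ((affineBlowup.idealSheaf (Ideal.span (Set.range (fun j : Fin 5 => Ideal.Quotient.mk (Ideal.span {f}) (X j))))).comap
      ((Spec (.of (MvPolynomial (Fin 5) k ⧸ Ideal.span {f}))).fromSpecStalk v))) :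
    (((affineBlowup.idealSheaf (Ideal.span (Set.range (fun j : Fin 5 => Ideal.Quotient.mk (Ideal.span {f}) (X j))))).comap
        ((Spec (.of (MvPolynomial (Fin 5) k ⧸ Ideal.span {f}))).fromSpecStalk v)) ≠ ⊥ ∧
      (((((affineBlowup.idealSheaf (Ideal.span (Set.range (fun j : Fin 5 => Ideal.Quotient.mk (Ideal.span {f}) (X j))))).comap
        ((Spec (.of (MvPolynomial (Fin 5) k ⧸ Ideal.span {f}))).fromSpecStalk v))).support :
          Set (Spec ((Spec (.of (MvPolynomial (Fin 5) k ⧸ Ideal.span {f}))).presheaf.stalk v))) ⊆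
        (Scheme.regularLocus (Spec ((Spec (.of (MvPolynomial (Fin 5) k ⧸ Ideal.span {f}))).presheaf.stalk v)))ᶜ) ∧
      (∀ s : S', g.base s ≠ closedPoint ((Spec (.of (MvPolynomial (Fin 5) k ⧸ Ideal.span {f}))).presheaf.stalk v) → s ∈ Scheme.regularLocus S') ∧
      (∀ s : S', CMCl (S'.presheaf.stalk s))) ∧
    (∃ s : S', g.base s = closedPoint ((Spec (.of (MvPolynomial (Fin 5) k ⧸ Ideal.span {f}))).presheaf.stalk v) ∧ ¬ FullCl 2 (S'.presheaf.stalk s)) ∧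
    (∃ 𝓚 : S'.IdealSheafData, 𝓚 ≠ ⊥ ∧
      (∀ s ∈ (𝓚.support : Set S'), g.base s = closedPoint ((Spec (.of (MvPolynomial (Fin 5) k ⧸ Ideal.span {f}))).presheaf.stalk v)) ∧
      ∀ (S'' : Scheme.{0}) (π : S'' ⟶ S'), IsBlowup π 𝓚 → ∀ s : S'', FullCl 2 (S''.presheaf.stalk s)) :=
  ⟨Sigma3P2d4F5PointFloor.pointFloor_sigma3F5_input_legal k f hf v hv S' g hg, Sigma3P2d4F5PointFloor.pointFloor_sigma3F5_not_full k f hf v hv S' g hg,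
    pointFloor_sigma3F5_row_class k f hf v hv S' g hg⟩

/-! ## §4 ★ The germ shape for `V(f′)` -/

/-- ★ **`FInjectivizationGermAt 2 v` AT THE VERTEX OF `V(f′)`** (`k = k̄`, char 2): one `𝔪`-primary monomial blowing up of `Spec 𝒪_{X′,v}` (along `𝔪·K`) is FULL at every stalk
(§1 + ✓ `GermOfGlobalBlowup.fInjectivizationGermAt_of_affineBlowup`). [OURS · certificate instance; cite: GortzWedhorn2020, Prop. 13.91 (2)] -/
theorem sigma3F5_fInjectivizationGermAt (k : Type) [Field k] [IsAlgClosed k] [CharP k 2] (f : MvPolynomial (Fin 5) k)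
    (hf : f = X 4 ^ 2 + X 0 ^ 2 * X 4 + X 0 ^ 5 + X 0 ^ 6 + X 1 ^ 5 + X 2 ^ 5 + X 3 ^ 5)
    (v : Spec (.of (MvPolynomial (Fin 5) k ⧸ Ideal.span {f})))
    (hv : v.asIdeal = Ideal.span (Set.range (fun j : Fin 5 => Ideal.Quotient.mk (Ideal.span {f}) (X j)))) :
    FInjectivizationGermAt 2 v := by
  classical
  haveI hp : (Ideal.span {f}).IsPrime := Sigma3P2d4F5Specimen.isPrime_span_f k f hf
  haveI : IsDomain (MvPolynomial (Fin 5) k ⧸ Ideal.span {f}) := Ideal.Quotient.isDomain _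
  have hpow : ∀ j : Fin 5, ∃ N : ℕ, (Ideal.Quotient.mk (Ideal.span {f}) (X j)) ^ N ∈
      Ideal.span ((fun e : Fin 5 →₀ ℕ => Ideal.Quotient.mk (Ideal.span {f}) (monomial e (1 : k))) '' (genSet 5 AL2 : Set (Fin 5 →₀ ℕ))) := by
    intro j
    obtain ⟨N, hN⟩ := hprimAJ.2.1 j (Finset.mem_univ j)
    refine ⟨N, ?_⟩
    have e : (Ideal.Quotient.mk (Ideal.span {f}) (X j)) ^ N = Ideal.Quotient.mk (Ideal.span {f}) (monomial (Finsupp.single j N) (1 : k)) := by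
      rw [← map_pow, X_pow_eq_monomial]
    rw [e]
    exact Ideal.subset_span ⟨_, Finset.mem_coe.mpr hN, rfl⟩
  refine GermOfGlobalBlowup.fInjectivizationGermAt_of_affineBlowup 2 _ ?_ v ?_ (affineBlowup_mK_fullCl_class k f hf)
  · obtain ⟨N, hN⟩ := hpow 0
    intro hbot
    rw [hbot, Ideal.mem_bot] at hN
    exact pow_ne_zero N (Sigma3P2d4F5Specimen.mk_X_ne_zero k f hf 0) hN
  · rw [hv, Ideal.span_le]
    rintro _ ⟨j, rfl⟩
    obtain ⟨N, hN⟩ := hpow j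
    exact ⟨N, hN⟩

/-! ## §5 ★★★ TRANSPORT TO THE CENSUS BED P2d4F5 (res-L1-w45a-stub-1ʼs `PolyAutRowTransport`) -/

/-- **`σ₃ f = f′`** (`σ₃ : z ↦ z + x³`, characteristic 2): `(z + x³)² + x²(z + x³) + y⁵ + u⁵ + t⁵ = z² + x²z + x⁵ + x⁶ + y⁵ + u⁵ + t⁵` since `2x³z = 0`. [folklore] -/
theorem aeval_shift_f5 (k : Type) [Field k] [CharP k 2] (f f' : MvPolynomial (Fin 5) k) (hf : f = X 4 ^ 2 + X 0 ^ 2 * X 4 + X 1 ^ 5 + X 2 ^ 5 + X 3 ^ 5)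
    (hf' : f' = X 4 ^ 2 + X 0 ^ 2 * X 4 + X 0 ^ 5 + X 0 ^ 6 + X 1 ^ 5 + X 2 ^ 5 + X 3 ^ 5) :
    aeval (fun l : Fin 5 => if l = 4 then X 4 + C (1 : k) * X 0 ^ 3 else (X l : MvPolynomial (Fin 5) k)) f = f' := by
  have h2 : (2 : MvPolynomial (Fin 5) k) = 0 := by
    have h := CharP.cast_eq_zero (MvPolynomial (Fin 5) k) 2
    simpa using h
  have e : aeval (fun l : Fin 5 => if l = 4 then X 4 + C (1 : k) * X 0 ^ 3 else (X l : MvPolynomial (Fin 5) k)) f = f' + 2 * (X 0 ^ 3 * X 4) := by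
    subst hf hf'
    simp only [map_add, map_mul, map_pow, aeval_X, C_1, one_mul]
    simp only [Fin.isValue, Fin.reduceEq, if_false, if_true]
    ring
  rw [e, h2, zero_mul, add_zero]

/-- ★★★ **THE POINT-FLOOR ROW OF P2d4F5 `z² + x²z + y⁵ + u⁵ + t⁵` (char 2, `k = k̄`) — LEGAL ∧ NOT F(4)-iso ∧ CURED — BY THE CLASS ROUTE**: §3 for `f′ = σ₃ f` transported along
`σ₃ : z ↦ z + x³` by res-L1-w45a-stub-1ʼs `PolyAutRowTransport.exists_translate` / `pointFloorRow_of_algEquiv`. [OURS · assembly of landed theorems; cite: GortzWedhorn2020, (13.19)] -/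
theorem pointFloorRow_P2d4F5_class (k : Type) [Field k] [IsAlgClosed k] [CharP k 2] (f : MvPolynomial (Fin 5) k)
    (hf : f = X 4 ^ 2 + X 0 ^ 2 * X 4 + X 1 ^ 5 + X 2 ^ 5 + X 3 ^ 5) :
    ∀ (v' : Spec (.of (MvPolynomial (Fin 5) k ⧸ Ideal.span {f}))),
      v'.asIdeal = Ideal.span (Set.range fun j : Fin 5 => Ideal.Quotient.mk (Ideal.span {f}) (X j)) →
      ∀ (S' : Scheme.{0}) (g₁ : S' ⟶ Spec ((Spec (.of (MvPolynomial (Fin 5) k ⧸ Ideal.span {f}))).presheaf.stalk v')),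
        IsBlowup g₁ ((affineBlowup.idealSheaf (Ideal.span (Set.range fun j : Fin 5 => Ideal.Quotient.mk (Ideal.span {f}) (X j)))).comap
          ((Spec (.of (MvPolynomial (Fin 5) k ⧸ Ideal.span {f}))).fromSpecStalk v')) →
        (((affineBlowup.idealSheaf (Ideal.span (Set.range fun j : Fin 5 => Ideal.Quotient.mk (Ideal.span {f}) (X j)))).comap
            ((Spec (.of (MvPolynomial (Fin 5) k ⧸ Ideal.span {f}))).fromSpecStalk v')) ≠ ⊥ ∧
          ((((affineBlowup.idealSheaf (Ideal.span (Set.range fun j : Fin 5 => Ideal.Quotient.mk (Ideal.span {f}) (X j)))).comap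
            ((Spec (.of (MvPolynomial (Fin 5) k ⧸ Ideal.span {f}))).fromSpecStalk v')).support :
              Set (Spec ((Spec (.of (MvPolynomial (Fin 5) k ⧸ Ideal.span {f}))).presheaf.stalk v'))) ⊆
            (Scheme.regularLocus (Spec ((Spec (.of (MvPolynomial (Fin 5) k ⧸ Ideal.span {f}))).presheaf.stalk v')))ᶜ) ∧
          (∀ s : S', g₁.base s ≠ closedPoint _ → s ∈ Scheme.regularLocus S') ∧ (∀ s : S', CMCl (S'.presheaf.stalk s))) ∧
        (∃ s : S', g₁.base s = closedPoint _ ∧ ¬ FullCl 2 (S'.presheaf.stalk s)) ∧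
        (∃ 𝓚 : S'.IdealSheafData, 𝓚 ≠ ⊥ ∧ (∀ s ∈ (𝓚.support : Set S'), g₁.base s = closedPoint _) ∧
          ∀ (S'' : Scheme.{0}) (π : S'' ⟶ S'), IsBlowup π 𝓚 → ∀ s : S'', FullCl 2 (S''.presheaf.stalk s)) :=
  by
  obtain ⟨φ, hφ, h₁, h₂⟩ := PolyAutRowTransport.exists_translate k (0 : Fin 5) 4 (by decide) (1 : k) 3 (by norm_num)
  exact PolyAutRowTransport.pointFloorRow_of_algEquiv k 2 φ h₁ h₂ f _ (by rw [hφ]; exact aeval_shift_f5 k f _ hf rfl)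
    (fun v hv S' g₁ hg₁ => f4pos_row_sigma3F5_class k _ rfl v hv S' g₁ hg₁)

/-- ★★★ **`FInjectivizationGermAt 2 v` AT THE VERTEX OF P2d4F5, BY THE CLASS ROUTE** (`k = k̄`, char 2): §4 for `f′` transported by `PolyAutRowTransport.fInjectivizationGermAt_of_algEquiv` —
a second, independent kernel proof of the germ conclusion of ✓ p612829 `P2d4F5Char2Germ`. [OURS · assembly of landed theorems; cite: GortzWedhorn2020, (13.19)] -/
theorem p2d4f5_fInjectivizationGermAt_class (k : Type) [Field k] [IsAlgClosed k] [CharP k 2] (f : MvPolynomial (Fin 5) k)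
    (hf : f = X 4 ^ 2 + X 0 ^ 2 * X 4 + X 1 ^ 5 + X 2 ^ 5 + X 3 ^ 5) :
    ∀ v' : Spec (.of (MvPolynomial (Fin 5) k ⧸ Ideal.span {f})),
      v'.asIdeal = Ideal.span (Set.range fun j : Fin 5 => Ideal.Quotient.mk (Ideal.span {f}) (X j)) → FInjectivizationGermAt 2 v' :=
  by
  obtain ⟨φ, hφ, h₁, h₂⟩ := PolyAutRowTransport.exists_translate k (0 : Fin 5) 4 (by decide) (1 : k) 3 (by norm_num)
  exact PolyAutRowTransport.fInjectivizationGermAt_of_algEquiv k 2 φ h₁ h₂ f _ (by rw [hφ]; exact aeval_shift_f5 k f _ hf rfl)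
    (fun v hv => sigma3F5_fInjectivizationGermAt k _ rfl v hv)

end Summit.ResolutionOfSingularities.ResolutionOfSingularities.Theorems.FInjectiveMacaulayfication.Sigma3P2d4F5PointFloorRowClass

end
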